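import Summits.NavierStokesRegularity.NavierStokesRegularity.Theorems.FrequencyRigidity.Negative.Clauses

/-!
# `FrequencyRigidity` (crux `stmt-NavierStokesRegularity-2955`): (B) the GLOBAL Type-I bound is
# load-bearing — rigid rotation — negative-side support (refuter, cdisprove), file 2 of 3

`AdaptedFrequency.FrequencyRigidity = ¬ ∃ (ν C Λ₀ v q K), …`: no smooth ancient Navier–Stokes
flow on `ℝ³ × (−∞,0)` with the GLOBAL Type-I bound `‖v(t,x)‖ ≤ C/√(−t)`, an adapted two-sided
Gaussian-comparable kernel `K` at `(0,0)`, positive adapted enstrophy `H` and constant adapted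
frequency `Λ ≡ Λ₀`.  No `¬`-theorem of the crux is claimed (a witness would contain a non-trivial
bounded mild ancient solution with Type-I decay at both ends — open, excluded by the KNSS
Liouville conjecture; see the crux work-file `Cruxes/FrequencyRigidity/Disproof.lean`).  These
files prove WHICH hypotheses any proof must use, each by an explicit witness whose adapted kernel
is the backward heat kernel (it is adapted to every flow tangent to the spheres about the pole).

This file (theorems only; objects in `Negative/Clauses.lean`): rigid rotation `v = rot x = e₃ × x`
with pressure `q = ½‖e₃ × x‖² = ½(x₁² + x₂²)` is a smooth steady (hence ancient) classical NS
flow on every time set (`isClassicalNSSolutionOn_rot`), tangent to the spheres about `0`, so the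
backward heat kernel is an adapted comparable kernel for it; `curl v ≡ 2e₃`, `H ≡ 4`, `Λ ≡ 0`.
Hence
* `frequencyRigidity_false_with_local_typeI` — the crux with the Type-I bound imposed only on the
  unit backward parabolic cylinder `Q₁(0,0)` (`LocalTypeIBound`) is FALSE;
* `frequencyRigidity_false_without_typeI` — a fortiori with the bound dropped.
So the spatially UNIFORM sup bound `‖v(t)‖∞ ≤ C/√(−t)` is essential: a "local Type-I at the
singular point" restatement of the crux would be false (rigid rotation has linear growth).

## References

* G. Koch, N. Nadirashvili, G. Seregin, V. Šverák, *Liouville theorems for the Navier–Stokes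
  equations and applications*, Acta Math. 203 (2009) 83–105. [KochNadirashviliSereginSverak2009]
* T.-P. Tsai, *On Leray's self-similar solutions of the Navier–Stokes equations satisfying local
  energy estimates*, Arch. Ration. Mech. Anal. 143 (1998) 29–51. [Tsai1998]
* C.-C. Poon, *Unique continuation for parabolic equations*, Comm. PDE 21 (1996) 521–539. [Poon1996]
-/

noncomputable section

set_option linter.dupNamespace false

namespace Summit.NavierStokesRegularity.NavierStokesRegularity.Theorems.FrequencyRigidity.Negative

open Literature.Analysis.FluidPDE Literature.Analysis.UnboundedOperators
open MeasureTheory Set Filter Topology Function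
open scoped Laplacian InnerProductSpace RealInnerProductSpace ContDiff

/-! ### (B) The GLOBAL Type-I bound is load-bearing: rigid rotation -/

/-- Unfolding `rot`. -/
theorem rot_apply (x : E3) : rot x = cross e₃ x := rfl

/-- First coordinate of `e₃ × x`. -/
@[simp] theorem rot_apply_zero (x : E3) : rot x 0 = -(x 1) := by
  simp [rot_apply, cross, cross_apply, e₃]

/-- Second coordinate of `e₃ × x`. -/
@[simp] theorem rot_apply_one (x : E3) : rot x 1 = x 0 := by
  simp [rot_apply, cross, cross_apply, e₃]

/-- Third coordinate of `e₃ × x`. -/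
@[simp] theorem rot_apply_two (x : E3) : rot x 2 = 0 := by
  simp [rot_apply, cross, cross_apply, e₃]

/-- Rigid rotation is tangent to the spheres about the origin (coordinates; the tree's
`inner_fin3`-type expansions are inlined to keep this file import-light). -/
theorem inner_self_rot (x : E3) : ⟪x, rot x⟫ = 0 := by
  rw [EuclideanSpace.inner_eq_star_dotProduct, star_trivial, dotProduct, Fin.sum_univ_three]
  simp only [rot_apply_zero, rot_apply_one, rot_apply_two]
  ring

/-- `rot` is skew-adjoint. -/
theorem rot_skew (x y : E3) : ⟪rot x, y⟫ = -⟪x, rot y⟫ := by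
  rw [EuclideanSpace.inner_eq_star_dotProduct, EuclideanSpace.inner_eq_star_dotProduct,
    star_trivial, star_trivial, dotProduct, dotProduct, Fin.sum_univ_three, Fin.sum_univ_three]
  simp only [rot_apply_zero, rot_apply_one, rot_apply_two]
  ring

/-- `‖e₃ × x‖ ≤ ‖x‖`. -/
theorem norm_rot_le (x : E3) : ‖rot x‖ ≤ ‖x‖ := by
  have h : ‖rot x‖ ^ 2 ≤ ‖x‖ ^ 2 := by
    rw [EuclideanSpace.real_norm_sq_eq, EuclideanSpace.real_norm_sq_eq, Fin.sum_univ_three,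
      Fin.sum_univ_three]
    simp only [rot_apply_zero, rot_apply_one, rot_apply_two]
    nlinarith [sq_nonneg (x 2)]
  exact (sq_le_sq₀ (norm_nonneg _) (norm_nonneg _)).1 h

/-- The vorticity of rigid rotation with unit angular velocity is `2e₃`. -/
theorem curl_rot (x : E3) : curl (⇑rot) x = (2:ℝ) • e₃ := by
  simp only [curl, ContinuousLinearMap.fderiv]
  ext i
  fin_cases i <;> (simp [rot_apply, cross, cross_apply, e₃]; try norm_num)

/-- `‖curl (e₃ × ·)‖² = 4`. -/
theorem norm_curl_rot_sq (x : E3) : ‖curl (⇑rot) x‖ ^ 2 = 4 := by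
  rw [curl_rot, norm_smul, e₃, PiLp.norm_single]
  norm_num

/-- **Rigid rotation is a smooth (steady, hence ancient) classical NS flow** on any time set, with
pressure `q = ½‖e₃ × x‖² = ½(x₁² + x₂²)`: `(v·∇)v = rot (rot x) = −∇q`, `Δv = 0`, `div v = 0`. -/
theorem isClassicalNSSolutionOn_rot (S : Set ℝ) (ν : ℝ) :
    IsClassicalNSSolutionOn S ν 0 (fun _ x => rot x) (fun _ x => 2⁻¹ * ‖rot x‖ ^ 2) where
  smooth_velocity := (rot.contDiff.comp contDiff_snd).contDiffOn
  smooth_pressure := ((contDiff_const.mul (rot.contDiff.norm_sq ℝ)).comp contDiff_snd).contDiffOn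
  momentum t ht x := by
    have hsq : HasFDerivAt (fun y : E3 => 2⁻¹ * ‖rot y‖ ^ 2)
        ((2⁻¹ : ℝ) • ((2 • innerSL ℝ (rot x)).comp rot)) x :=
      (((hasStrictFDerivAt_norm_sq (rot x)).hasFDerivAt.comp x rot.hasFDerivAt).const_mul 2⁻¹)
    have hP : HasFDerivAt (fun y : E3 => 2⁻¹ * ‖rot y‖ ^ 2)
        (InnerProductSpace.toDual ℝ E3 (-(rot (rot x)))) x := by
      refine hsq.congr_fderiv (ContinuousLinearMap.ext fun h => ?_)
      simp only [_root_.smul_apply, ContinuousLinearMap.comp_apply,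
        innerSL_apply_apply, InnerProductSpace.toDual_apply_apply, inner_neg_left, smul_eq_mul,
        nsmul_eq_mul, Nat.cast_ofNat]
      rw [rot_skew (rot x) h]
      ring
    have hgrad : gradient (fun y : E3 => 2⁻¹ * ‖rot y‖ ^ 2) x = -(rot (rot x)) :=
      (hasGradientAt_iff_hasFDerivAt.mpr hP).gradient
    have hΔ : (Δ (fun y : E3 => rot y)) x = 0 := laplacian_clm rot x
    have hconv : convect (fun y : E3 => rot y) (fun y : E3 => rot y) x = rot (rot x) := by
      rw [convect_apply, show (fun y : E3 => rot y) = ⇑rot from rfl, ContinuousLinearMap.fderiv]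
    simp only [timeDerivWithin_apply, derivWithin_fun_const, Pi.zero_apply, zero_add, add_zero,
      smul_zero, zero_sub, hconv, hΔ, hgrad, neg_neg]
  divFree t ht x := by
    show VectorCalculus.divergence (⇑rot) x = 0
    rw [divergence_eq_sum_inner_fderiv (stdOrthonormalBasis ℝ E3)]
    refine Finset.sum_eq_zero fun i _ => ?_
    rw [ContinuousLinearMap.fderiv]
    have h1 := rot_skew (stdOrthonormalBasis ℝ E3 i) (stdOrthonormalBasis ℝ E3 i)
    rw [real_inner_comm] at h1
    linarith

/-- The global Type-I bound implies the local one. -/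
theorem TypeIBound.localTypeIBound {C : ℝ} {v : ℝ → E3 → E3} (h : TypeIBound C v) :
    LocalTypeIBound C v :=
  fun t ht x _ => h t ht.2 x

/-- Dropping the bound is stronger than localising it. -/
theorem frequencyRigidityLocalTypeI_of_withoutTypeI (h : FrequencyRigidityWithoutTypeI) :
    FrequencyRigidityLocalTypeI := by
  rintro ⟨ν, C, Λ₀, v, q, K, hν, hNS, -, hK, hC, hF⟩
  exact h ⟨ν, Λ₀, v, q, K, hν, hNS, hK, hC, hF⟩

/-- Both variants are strengthenings of the crux. -/
theorem frequencyRigidity_of_localTypeI (h : FrequencyRigidityLocalTypeI) :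
    Theses.AdaptedFrequency.FrequencyRigidity := by
  rw [frequencyRigidity_iff]
  rintro ⟨ν, C, Λ₀, v, q, K, hν, hNS, hTI, hK, hC, hF⟩
  exact h ⟨ν, C, Λ₀, v, q, K, hν, hNS, hTI.localTypeIBound, hK, hC, hF⟩

/-- The no-Type-I variant is a strengthening of the crux. -/
theorem frequencyRigidity_of_withoutTypeI (h : FrequencyRigidityWithoutTypeI) :
    Theses.AdaptedFrequency.FrequencyRigidity :=
  frequencyRigidity_of_localTypeI (frequencyRigidityLocalTypeI_of_withoutTypeI h)

/-- The adapted enstrophy of rigid rotation against the heat kernel is the constant `4`. -/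
theorem adaptedEnstrophy_rot {ν : ℝ} (hν : 0 < ν) {t : ℝ} (ht : t < 0) :
    (∫ x, ‖curl ((fun (_ : ℝ) (x : E3) => rot x) t) x‖ ^ 2 * backwardHeatKernel ν 0 (0:E3) t x)
      = 4 := by
  have h1 : ∀ x, ‖curl ((fun (_ : ℝ) (x : E3) => rot x) t) x‖ ^ 2 = 4 := fun x =>
    norm_curl_rot_sq x
  simp_rw [h1, integral_const_mul, integral_backwardHeatKernel hν (0:E3) ht, mul_one]

/-- The frequency clause holds for rigid rotation with `Λ₀ = 0` (`H ≡ 4`, `H' ≡ 0`). -/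
theorem freqClause_rot {ν : ℝ} (hν : 0 < ν) :
    FreqClause (fun _ x => rot x) (backwardHeatKernel ν 0 (0:E3)) 0 := by
  intro H Λ hH hΛ
  have hH4 : ∀ t ∈ Iio (0:ℝ), H t = 4 := fun t ht => by
    rw [hH]; exact adaptedEnstrophy_rot hν ht
  refine ⟨fun t ht => by rw [hH4 t ht]; norm_num, fun t ht => ?_⟩
  have hev : H =ᶠ[𝓝 t] fun _ => (4:ℝ) :=
    Filter.eventuallyEq_of_mem (Iio_mem_nhds ht) fun s hs => hH4 s hs
  rw [hΛ]
  simp only [hev.deriv_eq, deriv_const, mul_zero, zero_div]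

/-- **(B, sharp form)** Replacing the global Type-I bound by the LOCAL one on `Q₁(0,0)` makes
the crux FALSE: rigid rotation `v = e₃ × x` (with `‖v‖ ≤ ‖x‖ ≤ 1 ≤ 1/√(−t)` on `Q₁`),
`q = ½(x₁² + x₂²)`, `K` = heat kernel, `Λ₀ = 0`, `H ≡ 4`. -/
theorem frequencyRigidity_false_with_local_typeI : ¬ FrequencyRigidityLocalTypeI := by
  intro h
  refine h ⟨1, 1, 0, fun _ x => rot x, fun _ x => 2⁻¹ * ‖rot x‖ ^ 2, backwardHeatKernel 1 0 (0:E3),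
    one_pos, isClassicalNSSolutionOn_rot _ _, ?_, ?_, comparable_backwardHeatKernel one_pos,
    freqClause_rot one_pos⟩
  · intro t ht x hx
    have hst : 0 < Real.sqrt (-t) := Real.sqrt_pos.2 (by linarith [ht.2])
    have hs1 : Real.sqrt (-t) ≤ 1 := Real.sqrt_le_one.mpr (by linarith [ht.1]) |>.trans_eq' rfl
    rw [le_div_iff₀ hst]
    calc ‖rot x‖ * Real.sqrt (-t) ≤ ‖x‖ * 1 :=
          mul_le_mul (norm_rot_le x) hs1 hst.le (norm_nonneg _)
      _ ≤ 1 := by simpa using hx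
  · exact kernelClauses_backwardHeatKernel one_pos _ (fun t _ x => inner_self_rot x)

/-- **(B)** Dropping the Type-I bound makes the crux FALSE (corollary of the sharp form). -/
theorem frequencyRigidity_false_without_typeI : ¬ FrequencyRigidityWithoutTypeI :=
  fun h => frequencyRigidity_false_with_local_typeI (frequencyRigidityLocalTypeI_of_withoutTypeI h)


end Summit.NavierStokesRegularity.NavierStokesRegularity.Theorems.FrequencyRigidity.Negative
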